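import Summits.AnomalousDissipation.AnomalousDissipation.Theses.MirrorVariety
import Literature.Analysis.FluidPDE.NSGalerkinStationary

/-!
# Sketch — crux-ideate stmt-AnomalousDissipation-2988 (`LaminarNeverLoud`), ideator 3, round 1

First lemmas of the idea cards, stated over existing declarations (signatures only, `sorry` bodies):

* card `swept-shell-no-spur`: `galerkinRHS_eq_zero_off_triad` (A1, isolation), `no_spur_isolated_triad`
  (A2, swept triads carry no steady states), `force_mode_balance` / energy floor (A3), `rayleigh_ceiling` (A4);
* card `monotone-reach-pde-shadow`: `power_sub_le` (B1, injection is ℓ²-Lipschitz),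
  `isConnected_union_kuratowskiLimsup` (B2, anchored limsup of connected sets is connected).
-/

noncomputable section

namespace Summit.AnomalousDissipation.AnomalousDissipation.Cruxes.LaminarNeverLoud.SketchIdeator3

open Filter Topology Set
open Literature.Analysis.FluidPDE Literature.Analysis.FunctionSpaces.Torus

/-- The resolved modes: the punctured ball `0 < |k|² ≤ N²`. -/
abbrev modes (N : ℕ) : Finset (Fin 3 → ℤ) := (freqBall N).erase 0

/-- The steady Galerkin variety of the crux (all real viscosities). -/
def steadySet (S : Finset (Fin 3 → ℤ)) (g : ↥S → EuclideanSpace ℂ (Fin 3)) :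
    Set ((↥S → EuclideanSpace ℂ (Fin 3)) × ℝ) :=
  {z | z.1 ∈ galerkinSubspace S ∧ galerkinRHS S z.2 g z.1 = 0}

/-- Coefficient energy `∑‖c k‖²`. -/
def energy {S : Finset (Fin 3 → ℤ)} (c : ↥S → EuclideanSpace ℂ (Fin 3)) : ℝ := ∑ k : ↥S, ‖c k‖ ^ 2

/-- Enstrophy sum `∑ |k|²‖c k‖²` (so dissipation `= ν·4π²·enstrophySum`). -/
def enstrophySum {S : Finset (Fin 3 → ℤ)} (c : ↥S → EuclideanSpace ℂ (Fin 3)) : ℝ :=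
  ∑ k : ↥S, freqNormSq (k : Fin 3 → ℤ) * ‖c k‖ ^ 2

/-- Power injected by the force: `∑ Re⟪g k, c k⟫` (`= dissipation` at steady states, Disproof §2). -/
def power {S : Finset (Fin 3 → ℤ)} (g c : ↥S → EuclideanSpace ℂ (Fin 3)) : ℝ :=
  ∑ k : ↥S, (inner ℂ (g k) (c k)).re

/-! ### Card `swept-shell-no-spur` -/

/-- A truncation-isolated ISOSCELES triad with forced apex `k`: `T = {±k, ±l, ±(k-l)}` resolved,
`2 l·k = |k|²` (so `|k - l| = |l|`), `|k| < |l|`, and every other pairwise sum of elements of `T`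
(`k+l`, `2k-l`, `2l-k`, `2l`, `2(k-l)`) unresolved (`2k` may be resolved: its symbol vanishes). -/
def IsIsolatedIsoscelesTriad (N : ℕ) (k l : Fin 3 → ℤ) : Prop :=
  k ∈ modes N ∧ l ∈ modes N ∧ k - l ∈ modes N ∧
    (2 : ℝ) * (∑ i, (l i : ℝ) * (k i : ℝ)) = freqNormSq k ∧ freqNormSq k < freqNormSq l ∧
    k + l ∉ freqBall N ∧ 2 • k - l ∉ freqBall N ∧ 2 • l - k ∉ freqBall N ∧
    2 • l ∉ freqBall N ∧ 2 • (k - l) ∉ freqBall N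

/-- The six triad modes. -/
def triadSupport (k l : Fin 3 → ℤ) : Finset (Fin 3 → ℤ) := {k, l, k - l, -k, -l, -(k - l)}

/-- **A1 (isolation).** If the force vector lives on `±k` and `c` lives on the isolated triad `T`,
the Galerkin field vanishes off `T`: `span T` is an invariant subsystem, so its steady states are
points of `V_N` and conversely every point of `V_N` supported on `T` solves the 6-mode system. -/
theorem galerkinRHS_eq_zero_off_triad (N : ℕ) (k l : Fin 3 → ℤ) (hT : IsIsolatedIsoscelesTriad N k l)
    (g c : ↥(modes N) → EuclideanSpace ℂ (Fin 3))
    (hg : g ∈ galerkinSubspace (modes N)) (hc : c ∈ galerkinSubspace (modes N))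
    (hgs : ∀ q : ↥(modes N), (q : Fin 3 → ℤ) ≠ k → (q : Fin 3 → ℤ) ≠ -k → g q = 0)
    (hcs : ∀ q : ↥(modes N), (q : Fin 3 → ℤ) ∉ triadSupport k l → c q = 0)
    (ν : ℝ) (q : ↥(modes N)) (hq : (q : Fin 3 → ℤ) ∉ triadSupport k l) :
    galerkinRHS (modes N) ν g c q = 0 := by
  sorry

/-- **A2 (no spur on a swept triad).** On a truncation-isolated isosceles triad with forced apex,
every steady Galerkin state with `ν ≠ 0` supported on the triad is the Stokes point: the parasitic
pair `±l, ±(k-l)` vanishes.  Reason: the `(l, k-l)` block of the steady system is LINEAR in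
`(c_l, conj c_{k-l})` given `c_k`, of the form `[[νΛ, -M₁],[-M₂, νΛ]]`, and
`M₁M₂ = -4π²(|p|² I - w₀ ⊗ k_⊥)` has spectrum `{-4π²|p|², -4π²|p|²(1 - |k|²/|l|²)²} ⊆ (-∞, 0]`
(`p = c_k · l`): sweeping by the large mode is skew, it cannot balance `ν²Λ² > 0`. -/
theorem no_spur_isolated_triad (N : ℕ) (k l : Fin 3 → ℤ) (hT : IsIsolatedIsoscelesTriad N k l)
    (g c : ↥(modes N) → EuclideanSpace ℂ (Fin 3))
    (hg : g ∈ galerkinSubspace (modes N))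
    (hgs : ∀ q : ↥(modes N), (q : Fin 3 → ℤ) ≠ k → (q : Fin 3 → ℤ) ≠ -k → g q = 0)
    (hcs : ∀ q : ↥(modes N), (q : Fin 3 → ℤ) ∉ triadSupport k l → c q = 0)
    {ν : ℝ} (hν : ν ≠ 0) (hz : (c, ν) ∈ steadySet (modes N) g) :
    ∀ q : ↥(modes N), ((q : Fin 3 → ℤ) = l ∨ (q : Fin 3 → ℤ) = k - l ∨ (q : Fin 3 → ℤ) = -l ∨
      (q : Fin 3 → ℤ) = -(k - l)) → c q = 0 := by
  sorry

/-- **A3 (force-mode balance ⇒ energy floor)**, valid at EVERY steady Galerkin state, uniformly in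
`N`: at a forced mode `k`, `‖g k‖ ≤ |ν|·4π²|k|²·‖c k‖ + 2π|k|·energy c` (divergence form of the
convection symbol: `|B(c,c)_k| ≤ 2π|k| ∑_{a+b=k} ‖c a‖‖c b‖ ≤ 2π|k|·energy`).  Hence at small `|ν|`
every steady state has `energy c ≥ ‖g k‖/(4π|k|)` unless `‖c k‖ ≥ ‖g k‖/(8π²|ν||k|²)`. -/
theorem force_mode_balance (N : ℕ) (g c : ↥(modes N) → EuclideanSpace ℂ (Fin 3))
    (hg : g ∈ galerkinSubspace (modes N)) (hc : c ∈ galerkinSubspace (modes N)) (ν : ℝ)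
    (h0 : galerkinRHS (modes N) ν g c = 0) (k : ↥(modes N)) :
    ‖g k‖ ≤ |ν| * (4 * Real.pi ^ 2 * freqNormSq (k : Fin 3 → ℤ)) * ‖c k‖ +
      2 * Real.pi * Real.sqrt (freqNormSq (k : Fin 3 → ℤ)) * energy c := by
  sorry

/-- **A4 (Rayleigh-quotient ceiling at fixed viscosity)**, every steady state, uniformly in `N`:
`|ν|·4π²·enstrophySum c ≤ √(energy g)·√(energy c)` (power identity + Cauchy–Schwarz; with A3 this
bounds `enstrophySum/energy` at each fixed `ν ≠ 0` by a constant of the force alone). -/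
theorem rayleigh_ceiling (N : ℕ) (g c : ↥(modes N) → EuclideanSpace ℂ (Fin 3))
    (hg : g ∈ galerkinSubspace (modes N)) (hc : c ∈ galerkinSubspace (modes N)) (ν : ℝ)
    (h0 : galerkinRHS (modes N) ν g c = 0) :
    |ν| * (4 * Real.pi ^ 2 * enstrophySum c) ≤ Real.sqrt (energy g) * Real.sqrt (energy c) := by
  sorry

/-! ### Card `monotone-reach-pde-shadow` -/

/-- **B1 (loudness is an `ℓ²`-Lipschitz functional).** The power — hence, at steady states, the
dissipation — moves by at most `‖g‖₂‖c - c'‖₂`; no `H¹` control is needed to pass quiet/loud to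
`ℓ²`-limits. -/
theorem power_sub_le {S : Finset (Fin 3 → ℤ)} (g c c' : ↥S → EuclideanSpace ℂ (Fin 3)) :
    |power g c - power g c'| ≤ Real.sqrt (energy g) * Real.sqrt (energy (c - c')) := by
  sorry

/-- The Kuratowski upper limit of a sequence of sets in a metric space: points approached along a
subsequence. -/
def kuratowskiLimsup {X : Type*} [MetricSpace X] (K : ℕ → Set X) : Set X :=
  {x | ∀ ε > 0, ∃ᶠ n in atTop, ∃ y ∈ K n, dist x y < ε}

/-- **B2 (anchored limsup of connected sets is connected).** In a compact metric space, if every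
`K n` is connected and meets a fixed closed connected set `A`, then `A ∪ limsup K n` is connected
(Kuratowski, Topology II §47). Applied to the first-arrival pieces of the laminar components inside
the compact region `{ν' ≥ ν, energy ≤ ‖g‖²/(16π⁴ν²)}` (anchored at the Stokes arc), it makes their
`N → ∞` shadow a continuum of PDE steady states through the Stokes branch. -/
theorem isConnected_union_kuratowskiLimsup {X : Type*} [MetricSpace X] [CompactSpace X]
    (A : Set X) (hA : IsConnected A) (hAc : IsClosed A) (K : ℕ → Set X)
    (hK : ∀ n, IsConnected (K n)) (hKA : ∀ n, (K n ∩ A).Nonempty) :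
    IsConnected (A ∪ kuratowskiLimsup K) := by
  sorry

/-- **B3 (the monotone laminar set).** Points of `V` connected to viscosities `≥ Λ` for every `Λ`
WITHOUT dipping below their own viscosity level: the sub-case of the crux that the PDE shadow
governs (`IsMonotoneLaminar V z → IsLaminar V z`). -/
def IsMonotoneLaminar {Y : Type*} [TopologicalSpace Y] (V : Set (Y × ℝ)) (z : Y × ℝ) : Prop :=
  ∀ Λ : ℝ, ∃ z' ∈ connectedComponentIn (V ∩ {w | z.2 ≤ w.2}) z, Λ ≤ z'.2

theorem isMonotoneLaminar_imp_laminar {Y : Type*} [TopologicalSpace Y] (V : Set (Y × ℝ)) (z : Y × ℝ)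
    (h : IsMonotoneLaminar V z) : ∀ Λ : ℝ, ∃ z' ∈ connectedComponentIn V z, Λ ≤ z'.2 := by
  intro Λ
  obtain ⟨z', hz', hΛ⟩ := h Λ
  exact ⟨z', connectedComponentIn_mono _ inter_subset_left hz', hΛ⟩

end Summit.AnomalousDissipation.AnomalousDissipation.Cruxes.LaminarNeverLoud.SketchIdeator3
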